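/-
Copyright (c) 2026 the pub-hodgecm-mathlib formalisation cell (harness21).  Prover seat hodgecm-mathlib-B-p14 (g42): INDEX TWO for a unit of odd quadratic defect, over ★ 63:11
and ★ (C2) (LH4-plan (g3) WORDs #25∕#30∕#35; census F0P3a-p06 (g17) §3); 2026-09-02.
-/
import Literature.NumberTheory.LocalFields.WildQuadraticNormsUnitConductor   -- ★ (C1), (C2), `−w`-transport; brings ★ IndexTwo, Descent, Exactness, NearOne
import HarnessLib

/-!
# Wild quadratic norms — INDEX TWO for a unit `u = 1 + w` of ODD quadratic defect: `K^× = N(K(√u)^×) ⊔ (1 + 4η∕w)·N(K(√u)^×)` (`η̄ ∉ ℘(𝓀)`), from Hensel's lemma alone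

Topic `NumberTheory/LocalFields`; namespace `Literature.NumberTheory.LocalFields`.  THEOREMS ONLY (no definition, no instance, no notation, no named fact, no `sorry`);
CM-free; kernel lane `--supports stmt-HodgeConjecture-24833`.  Cell `pub/hodgecm-mathlib` (D-0151), crux H413 = `stmt-HodgeConjecture-24833`; half A line LH4, DYADIC
pay-down leaf `Cruxes/H413/Lines/F0_P3c_DyadicPaydown.lean`, organs (D-UNR)∕(D-RAM) (PRINT this week; census F0P3a-p06 (g17) OUTCOME B).  Sixth file of the wild quadratic
entry layer: ★ `WildQuadraticNormsNearOne` ((W1)–(W4)) · ★ `WildQuadraticNormsExactness` ((X1)–(X6)) · ★ `WildQuadraticNormDescent` · ★ `WildQuadraticNormIndexTwo` (O'Meara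
63:11 for `u` of ODD ORDER) · ★ `WildQuadraticNormsUnitConductor` ((C1) complementary depths, (C2) the symbol `(1 + w, 1 + 4η∕w) = −1`).  Same define-free currency
(`Valued.v : K → ℤᵐ⁰`; «`x ∈ N_u = N(K(√u)^×)`» := `∃ a b, a·a − u·(b·b) = x`; «`η̄ ∉ ℘(𝓀)`» := `∀ ρ, v ρ ≤ 1 → 1 ≤ v(ρ·ρ + ρ − η)`; «`[𝓀 : ℘(𝓀)] = 2`» := the binder
`hAS2`; «odd» := `∀ y, v w ≠ v y·v y`; uniformiser binder `hϖ : v ϖ = exp(−1)`).  HONEST LABEL: HC_CM is proved only modulo the 7 printed citations (2 remaining named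
inputs: hLiu418 = stmt-HodgeConjecture-24832, h413 = stmt-HodgeConjecture-24833) until rung 0 closes; count-neutral, Mathlib-footed, bankable.

THE MATHEMATICS (`u = 1 + w`, `v 4 < v w < 1`, `ord w` odd, `x₀ = 1 + 4η∕w` with `η̄ ∉ ℘(𝓀)`, so `x₀ ∉ N_u` by ★ (C2)):
* `exists_sq_sub_one_add_mul_sq_or_mul_of_valued_eq_one` — a UNIT `y`: `D₁ = −wy` and `D₂ = −w(yx₀) = D₁x₀` have odd order, and `y ∈ N_u ⟺ u ∈ N_{D₁}`,
  `yx₀ ∈ N_u ⟺ u ∈ N_{D₂}` (★ `−w`-transport + ★ symmetry).  ★ 63:11 (`…_or_mul_delta_of_valued_eq_one` with `Δ := 1 + 4η`) for `D₁`: `u ∈ N_{D₁}` — done — or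
  `uΔ ∈ N_{D₁}`; then `uΔ ∉ N_{D₂}` (else `D₁, D₂ ∈ N_{uΔ}` by symmetry, so `x₀ = D₂∕D₁ ∈ N_{uΔ}`; but `uΔ = (1 + w)(1 + 4η) = 1 + w̃`, `w̃ = w + 4η(1 + w)` of the SAME odd
  value, and `x₀ = 1 + 4η̃∕w̃` with `η̃ = ηw̃∕w ≡ η` — ★ (C2) for `(w̃, η̃)`), hence `u ∈ N_{D₂}` by ★ «not both ⇒ one» (`…_iff_not_mul_delta`) and `yx₀ ∈ N_u`.
* `exists_sq_sub_one_add_mul_sq_or_mul` — ALL `y ≠ 0`: even order ⇒ `y·(ϖ^r)²` is a unit; odd order ⇒ `y·(−w)` has even order and `−w ∈ N_u`.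
* `exists_sq_sub_one_add_mul_sq_iff_not_mul` — NOT BOTH (`x₀ = (yx₀)·y⁻¹ ∉ N_u`, ★ (C2)): **`K^× = N_u ⊔ x₀N_u`, `[K^× : N(K(√(1+w))^×)] = 2`** for every unit of odd
  defect.  With ★ 63:11 (odd order) and ★ `exists_sq_sub_delta_mul_sq_iff_valued_eq_sq` (the `Δ`-class), the local norm index is `2` for every quadratic class of a dyadic
  field in ★-ladder normal form — local class field theory's prediction, from Hensel's lemma alone.
* `exists_norm_dichotomy_one_add_of_finite_residueField`, `…_adicCompletion` — the dresses (`hres`, `hAS2`, `η` discharged from `[Finite 𝓀[K]]`; `F_v` at `v ∣ 2`).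

## References
* [Omeara1963] O. T. O'Meara, *Introduction to Quadratic Forms*, Grundlehren 117 (1963), §63B 63:9–63:11a (held copy p. 167–170), §63A 63:2–63:5.
* [Serre1979] J.-P. Serre, *Local Fields*, GTM 67 (1979), Ch. XIV §§3–4 (local symbols, the dyadic computation); Ch. XV §2 (norm groups).
* [NeukirchANT1999] J. Neukirch, *Algebraic Number Theory* (1999), Ch. V (1.3) (local norm index), Ch. V §3 (Hilbert symbol at dyadic places).
-/

set_option autoImplicit false

noncomputable section

open scoped Valued WithZero
open WithZero NumberField IsDedekindDomain

namespace Literature.NumberTheory.LocalFields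

section UnitIndexTwo
variable {K : Type*} [Field K] [Valued K ℤᵐ⁰]

/-- **INDEX TWO FOR A UNIT OF ODD DEFECT — UNITS.**  `K` complete, `2 ≠ 0`, `v 2 < 1`, `hres`, `hAS2`, a uniformiser `ϖ`; `v 4 < v w < 1` with `v w` not a square value;
`η̄ ∉ ℘(𝓀)`.  Then every UNIT `y` lies in `N(K(√(1+w)))` or in `(1 + 4η∕w)·N(K(√(1+w)))`.  Proof: `D₁ = −wy`, `D₂ = D₁(1 + 4η∕w)` (odd order); ★ 63:11 for `D₁` with
`Δ := 1 + 4η`; in the `uΔ ∈ N_{D₁}` branch, `uΔ ∉ N_{D₂}` by ★ (C2) for `uΔ = 1 + w̃` (same odd defect, `η̃ ≡ η`), so `u ∈ N_{D₂}`; transport back by ★ symmetry and `(−w)⁻¹`.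
[cite: Omeara1963, §63B 63:11–63:11a] [cite: Serre1979, Ch. XIV §4; Ch. XV §2] -/
theorem exists_sq_sub_one_add_mul_sq_or_mul_of_valued_eq_one [IsAdicComplete 𝓂[K] 𝒪[K]] (h2 : (2 : K) ≠ 0) (h2v : Valued.v (2 : K) < 1)
    (hres : ∀ c : K, Valued.v c ≤ 1 → ∃ y : K, Valued.v y ≤ 1 ∧ Valued.v (y * y - c) < 1)
    (hAS2 : ∀ η η' : K, Valued.v η ≤ 1 → Valued.v η' ≤ 1 →
      (∀ ρ : K, Valued.v ρ ≤ 1 → 1 ≤ Valued.v (ρ * ρ + ρ - η)) → (∀ ρ : K, Valued.v ρ ≤ 1 → 1 ≤ Valued.v (ρ * ρ + ρ - η')) →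
      ∃ ρ : K, Valued.v ρ ≤ 1 ∧ Valued.v (ρ * ρ + ρ - (η + η')) < 1)
    {ϖ : K} (hϖ : Valued.v ϖ = exp (-1 : ℤ)) {w : K} (hw1 : Valued.v w < 1) (h4w : Valued.v (4 : K) < Valued.v w)
    (hwodd : ∀ y : K, Valued.v w ≠ Valued.v y * Valued.v y)
    {η : K} (hη1 : Valued.v η ≤ 1) (hη : ∀ ρ : K, Valued.v ρ ≤ 1 → 1 ≤ Valued.v (ρ * ρ + ρ - η)) {y : K} (hy : Valued.v y = 1) :
    (∃ a b : K, a * a - (1 + w) * (b * b) = y) ∨ (∃ a b : K, a * a - (1 + w) * (b * b) = y * (1 + 4 * η * w⁻¹)) := by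
  have hw0 : w ≠ 0 := fun h => hwodd 0 (by rw [h, map_zero, mul_zero])
  have hvw0 : Valued.v w ≠ 0 := (Valuation.ne_zero_iff _).2 hw0
  have hu1 : Valued.v (1 + w) = 1 := Valuation.map_one_add_of_lt _ hw1
  have hu0 : 1 + w ≠ 0 := (Valuation.ne_zero_iff _).1 (by rw [hu1]; exact one_ne_zero)
  have hy0 : y ≠ 0 := (Valuation.ne_zero_iff _).1 (by rw [hy]; exact one_ne_zero)
  have hv4le1 : Valued.v (4 * η) ≤ Valued.v (4 : K) := by
    rw [map_mul]
    exact mul_le_of_le_one_right' hη1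
  -- `x₀ := 1 + 4η∕w` is a unit
  have hx₀1 : Valued.v (1 + 4 * η * w⁻¹) = 1 := by
    refine Valuation.map_one_add_of_lt _ ?_
    rw [map_mul, map_inv₀]
    calc Valued.v (4 * η) * (Valued.v w)⁻¹ < Valued.v w * (Valued.v w)⁻¹ := mul_lt_mul_of_pos_right (hv4le1.trans_lt h4w) (zero_lt_iff.2 (inv_ne_zero hvw0))
      _ = 1 := mul_inv_cancel₀ hvw0
  have hx₀0 : 1 + 4 * η * w⁻¹ ≠ 0 := (Valuation.ne_zero_iff _).1 (by rw [hx₀1]; exact one_ne_zero)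
  -- `D₁ = −wy`, `D₂ = −w(y x₀)`: odd order
  have hD₁odd : ∀ t : K, Valued.v (-(w * y)) ≠ Valued.v t * Valued.v t := by
    rw [Valuation.map_neg, map_mul, hy, mul_one]
    exact hwodd
  have hD₂odd : ∀ t : K, Valued.v (-(w * (y * (1 + 4 * η * w⁻¹)))) ≠ Valued.v t * Valued.v t := by
    rw [Valuation.map_neg, map_mul, map_mul, hy, hx₀1, mul_one, mul_one]
    exact hwodd
  have hD₁0 : -(w * y) ≠ 0 := neg_ne_zero.2 (mul_ne_zero hw0 hy0)
  -- ★ 63:11 for `D₁` with `Δ := 1 + 4η`, applied to the unit `u = 1 + w`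
  rcases exists_sq_sub_mul_sq_or_mul_delta_of_valued_eq_one h2 h2v hres hAS2 hϖ hD₁odd hη1 hη hu1 with hA | hB
  · -- `u ∈ N_{D₁}` ⇒ `D₁ ∈ N_u` ⇒ `y ∈ N_u`
    exact Or.inl ((exists_sq_sub_one_add_mul_sq_iff_neg_mul hw0 y).2 (exists_sq_sub_mul_sq_symm h2 hu0 hA))
  · -- `uΔ ∈ N_{D₁}`; show `u ∈ N_{D₂}`
    refine Or.inr ((exists_sq_sub_one_add_mul_sq_iff_neg_mul hw0 _).2 (exists_sq_sub_mul_sq_symm h2 hu0 ?_))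
    refine (exists_sq_sub_mul_sq_iff_not_mul_delta h2 h2v hres hAS2 hϖ hD₂odd hη1 hη hu0).2 fun hB2 => ?_
    -- both `D₁, D₂ ∈ N_{uΔ}`, hence `x₀ = D₂ D₁⁻¹ ∈ N_{uΔ}`
    have huΔ0 : (1 + w) * (1 + 4 * η) ≠ 0 := by
      refine mul_ne_zero hu0 ((Valuation.ne_zero_iff Valued.v).1 ?_)
      rw [Valuation.map_one_add_of_lt _ (hv4le1.trans_lt (h4w.trans hw1))]
      exact one_ne_zero
    have h1 := exists_sq_sub_mul_sq_symm h2 huΔ0 hB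
    have h2' := exists_sq_sub_mul_sq_symm h2 huΔ0 hB2
    have hx₀N : ∃ c d : K, c * c - (1 + w) * (1 + 4 * η) * (d * d) = 1 + 4 * η * w⁻¹ := by
      have h := exists_sq_sub_mul_sq_eq_mul _ h2' (exists_sq_sub_mul_sq_eq_inv _ h1)
      rwa [show -(w * (y * (1 + 4 * η * w⁻¹))) * (-(w * y))⁻¹ = 1 + 4 * η * w⁻¹ by field_simp] at h
    -- `uΔ = 1 + w̃`, `w̃ = w + 4η(1 + w)`, same odd value; `x₀ = 1 + 4η̃∕w̃`, `η̃ = η w̃ w⁻¹ ≡ η`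
    have hwt : Valued.v (w + 4 * η * (1 + w)) = Valued.v w := by
      refine Valuation.map_add_eq_of_lt_left _ ?_
      rw [map_mul, hu1, mul_one]
      exact hv4le1.trans_lt h4w
    have hwt0 : w + 4 * η * (1 + w) ≠ 0 := (Valuation.ne_zero_iff _).1 (by rw [hwt]; exact hvw0)
    have hηt1 : Valued.v (η * ((w + 4 * η * (1 + w)) * w⁻¹)) ≤ 1 := by
      rw [map_mul, map_mul, map_inv₀, hwt, mul_inv_cancel₀ hvw0, mul_one]
      exact hη1
    have hηt : ∀ ρ : K, Valued.v ρ ≤ 1 → 1 ≤ Valued.v (ρ * ρ + ρ - η * ((w + 4 * η * (1 + w)) * w⁻¹)) := by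
      refine forall_one_le_valued_artinSchreier_sub_of_valued_sub_lt_one hη ?_
      have hdiff : η * ((w + 4 * η * (1 + w)) * w⁻¹) - η = (4 * η) * (η * (1 + w)) * w⁻¹ := by
        field_simp
        ring
      rw [hdiff, map_mul, map_mul, map_inv₀, Valuation.map_mul _ η (1 + w), hu1, mul_one]
      calc Valued.v (4 * η) * Valued.v η * (Valued.v w)⁻¹ ≤ Valued.v (4 * η) * 1 * (Valued.v w)⁻¹ :=
            mul_le_mul_left (mul_le_mul_right hη1 _) _
        _ = Valued.v (4 * η) * (Valued.v w)⁻¹ := by rw [mul_one]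
        _ < Valued.v w * (Valued.v w)⁻¹ := mul_lt_mul_of_pos_right (hv4le1.trans_lt h4w) (zero_lt_iff.2 (inv_ne_zero hvw0))
        _ = 1 := mul_inv_cancel₀ hvw0
    have hwt1 : Valued.v (w + 4 * η * (1 + w)) < 1 := by rw [hwt]; exact hw1
    have h4wt : Valued.v (4 : K) < Valued.v (w + 4 * η * (1 + w)) := by rw [hwt]; exact h4w
    have hwtodd : ∀ t : K, Valued.v (w + 4 * η * (1 + w)) ≠ Valued.v t * Valued.v t := by rw [hwt]; exact hwodd
    refine not_exists_sq_sub_one_add_mul_sq_eq_one_add_four_mul_mul_inv h2 h2v hwt1 h4wt hwtodd hηt1 hηt ?_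
    have hid1 : (1 + w) * (1 + 4 * η) = 1 + (w + 4 * η * (1 + w)) := by ring
    have hid2 : 1 + 4 * (η * ((w + 4 * η * (1 + w)) * w⁻¹)) * (w + 4 * η * (1 + w))⁻¹ = 1 + 4 * η * w⁻¹ := by field_simp
    rw [← hid1, hid2]
    exact hx₀N

/-- **INDEX TWO FOR A UNIT OF ODD DEFECT — ALL `y ≠ 0`** (same hypotheses): `y ∈ N(K(√(1+w)))` or `y·(1 + 4η∕w) ∈ N(K(√(1+w)))`.  Reduction to units: an `y` of even order is a
unit times `(ϖ^r)²` (a norm); an `y` of odd order becomes of even order after multiplying by the odd-order NORM `−w = 1 − (1 + w)`.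
[cite: Omeara1963, §63B 63:11–63:11a] [cite: Serre1979, Ch. XIV §4; Ch. XV §2] [cite: NeukirchANT1999, Ch. V (1.3)] -/
theorem exists_sq_sub_one_add_mul_sq_or_mul [IsAdicComplete 𝓂[K] 𝒪[K]] (h2 : (2 : K) ≠ 0) (h2v : Valued.v (2 : K) < 1)
    (hres : ∀ c : K, Valued.v c ≤ 1 → ∃ y : K, Valued.v y ≤ 1 ∧ Valued.v (y * y - c) < 1)
    (hAS2 : ∀ η η' : K, Valued.v η ≤ 1 → Valued.v η' ≤ 1 →
      (∀ ρ : K, Valued.v ρ ≤ 1 → 1 ≤ Valued.v (ρ * ρ + ρ - η)) → (∀ ρ : K, Valued.v ρ ≤ 1 → 1 ≤ Valued.v (ρ * ρ + ρ - η')) →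
      ∃ ρ : K, Valued.v ρ ≤ 1 ∧ Valued.v (ρ * ρ + ρ - (η + η')) < 1)
    {ϖ : K} (hϖ : Valued.v ϖ = exp (-1 : ℤ)) {w : K} (hw1 : Valued.v w < 1) (h4w : Valued.v (4 : K) < Valued.v w)
    (hwodd : ∀ y : K, Valued.v w ≠ Valued.v y * Valued.v y)
    {η : K} (hη1 : Valued.v η ≤ 1) (hη : ∀ ρ : K, Valued.v ρ ≤ 1 → 1 ≤ Valued.v (ρ * ρ + ρ - η)) {y : K} (hy0 : y ≠ 0) :
    (∃ a b : K, a * a - (1 + w) * (b * b) = y) ∨ (∃ a b : K, a * a - (1 + w) * (b * b) = y * (1 + 4 * η * w⁻¹)) := by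
  have hϖ0 : ϖ ≠ 0 := (Valuation.ne_zero_iff _).1 (by rw [hϖ]; exact exp_ne_zero)
  have hw0 : w ≠ 0 := fun h => hwodd 0 (by rw [h, map_zero, mul_zero])
  obtain ⟨m, hwm⟩ := exists_valued_eq_exp_odd hϖ hwodd
  -- even order ⇒ unit after a square
  have heven : ∀ z : K, z ≠ 0 → (∃ r : ℤ, log (Valued.v z) = r + r) →
      (∃ a b : K, a * a - (1 + w) * (b * b) = z) ∨ (∃ a b : K, a * a - (1 + w) * (b * b) = z * (1 + 4 * η * w⁻¹)) := by
    intro z hz0 ⟨r, hr⟩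
    have hvz0 : Valued.v z ≠ 0 := (Valuation.ne_zero_iff _).2 hz0
    have hunit : Valued.v (z * (ϖ ^ r * ϖ ^ r)) = 1 := by
      rw [map_mul, map_mul, valued_uniformizer_zpow hϖ, ← exp_log hvz0, hr, ← exp_add, ← exp_add, ← exp_zero, exp_inj]
      ring
    have hs0 : ϖ ^ r ≠ 0 := zpow_ne_zero _ hϖ0
    rcases exists_sq_sub_one_add_mul_sq_or_mul_of_valued_eq_one h2 h2v hres hAS2 hϖ hw1 h4w hwodd hη1 hη hunit with h | h
    · refine Or.inl ?_
      have h' := exists_sq_sub_mul_sq_eq_mul _ h (exists_sq_sub_mul_sq_eq_mul_self _ (ϖ ^ r)⁻¹)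
      rwa [show z * (ϖ ^ r * ϖ ^ r) * ((ϖ ^ r)⁻¹ * (ϖ ^ r)⁻¹) = z by field_simp] at h'
    · refine Or.inr ?_
      have h' := exists_sq_sub_mul_sq_eq_mul _ h (exists_sq_sub_mul_sq_eq_mul_self _ (ϖ ^ r)⁻¹)
      rwa [show z * (ϖ ^ r * ϖ ^ r) * (1 + 4 * η * w⁻¹) * ((ϖ ^ r)⁻¹ * (ϖ ^ r)⁻¹) = z * (1 + 4 * η * w⁻¹) by field_simp] at h'
  rcases Int.even_or_odd (log (Valued.v y)) with ⟨r, hr⟩ | ⟨j, hj⟩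
  · exact heven y hy0 ⟨r, hr⟩
  · -- odd order: `y·(−w)` has even order, and `−w ∈ N_u`
    have hvy0 : Valued.v y ≠ 0 := (Valuation.ne_zero_iff _).2 hy0
    have hvw0 : Valued.v w ≠ 0 := (Valuation.ne_zero_iff _).2 hw0
    have hy' : ∃ r : ℤ, log (Valued.v (y * -w)) = r + r := by
      refine ⟨j - m, ?_⟩
      rw [map_mul, Valuation.map_neg, log_mul hvy0 hvw0, hwm, log_exp, hj]
      ring
    rcases heven (y * -w) (mul_ne_zero hy0 (neg_ne_zero.2 hw0)) hy' with h | h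
    · refine Or.inl ?_
      have h' := exists_sq_sub_mul_sq_eq_mul _ h (exists_sq_sub_mul_sq_eq_inv _ (exists_sq_sub_one_add_mul_sq_eq_neg w))
      rwa [show y * -w * (-w)⁻¹ = y by field_simp] at h'
    · refine Or.inr ?_
      have h' := exists_sq_sub_mul_sq_eq_mul _ h (exists_sq_sub_mul_sq_eq_inv _ (exists_sq_sub_one_add_mul_sq_eq_neg w))
      rwa [show y * -w * (1 + 4 * η * w⁻¹) * (-w)⁻¹ = y * (1 + 4 * η * w⁻¹) by field_simp] at h'

/-- **NOT BOTH, hence `[K^× : N(K(√(1+w))^×)] = 2`** (same hypotheses): `y ∈ N_u ↔ y·(1 + 4η∕w) ∉ N_u` — ⇒ because `N_u` is a group and `1 + 4η∕w ∉ N_u` (★ (C2)), ⇐ by the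
exhaustion above.  The define-free `K^× = N(K(√u)^×) ⊔ (1 + 4η∕w)·N(K(√u)^×)` for every unit `u = 1 + w` of odd quadratic defect at a dyadic place.
[cite: Omeara1963, §63B 63:11–63:11a] [cite: NeukirchANT1999, Ch. V (1.3)] -/
theorem exists_sq_sub_one_add_mul_sq_iff_not_mul [IsAdicComplete 𝓂[K] 𝒪[K]] (h2 : (2 : K) ≠ 0) (h2v : Valued.v (2 : K) < 1)
    (hres : ∀ c : K, Valued.v c ≤ 1 → ∃ y : K, Valued.v y ≤ 1 ∧ Valued.v (y * y - c) < 1)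
    (hAS2 : ∀ η η' : K, Valued.v η ≤ 1 → Valued.v η' ≤ 1 →
      (∀ ρ : K, Valued.v ρ ≤ 1 → 1 ≤ Valued.v (ρ * ρ + ρ - η)) → (∀ ρ : K, Valued.v ρ ≤ 1 → 1 ≤ Valued.v (ρ * ρ + ρ - η')) →
      ∃ ρ : K, Valued.v ρ ≤ 1 ∧ Valued.v (ρ * ρ + ρ - (η + η')) < 1)
    {ϖ : K} (hϖ : Valued.v ϖ = exp (-1 : ℤ)) {w : K} (hw1 : Valued.v w < 1) (h4w : Valued.v (4 : K) < Valued.v w)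
    (hwodd : ∀ y : K, Valued.v w ≠ Valued.v y * Valued.v y)
    {η : K} (hη1 : Valued.v η ≤ 1) (hη : ∀ ρ : K, Valued.v ρ ≤ 1 → 1 ≤ Valued.v (ρ * ρ + ρ - η)) {y : K} (hy0 : y ≠ 0) :
    (∃ a b : K, a * a - (1 + w) * (b * b) = y) ↔ ¬ ∃ a b : K, a * a - (1 + w) * (b * b) = y * (1 + 4 * η * w⁻¹) := by
  constructor
  · intro hy hyx
    have h := exists_sq_sub_mul_sq_eq_mul _ hyx (exists_sq_sub_mul_sq_eq_inv _ hy)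
    rw [show y * (1 + 4 * η * w⁻¹) * y⁻¹ = 1 + 4 * η * w⁻¹ by field_simp] at h
    exact not_exists_sq_sub_one_add_mul_sq_eq_one_add_four_mul_mul_inv h2 h2v hw1 h4w hwodd hη1 hη h
  · intro h
    exact (exists_sq_sub_one_add_mul_sq_or_mul h2 h2v hres hAS2 hϖ hw1 h4w hwodd hη1 hη hy0).resolve_right h

/-- **INDEX TWO FOR A UNIT OF ODD DEFECT, FINITE RESIDUE FIELD** (`hres`, `hAS2`, `η` discharged): `K` complete, `[Finite 𝓀[K]]`, `2 ≠ 0`, `v 2 < 1`, uniformiser `ϖ`, `v 4 < v w < 1`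
with `v w` not a square value.  There is `η ∈ 𝒪` with `x₀ = 1 + 4η∕w ∉ N(K(√(1+w)))` and `∀ y ≠ 0, y ∈ N ∨ y·x₀ ∈ N`. [cite: Omeara1963, §63B 63:11a]
[cite: Serre1979, Ch. XV §2] [cite: NeukirchANT1999, Ch. V (1.3)] -/
theorem exists_norm_dichotomy_one_add_of_finite_residueField [IsAdicComplete 𝓂[K] 𝒪[K]] [Finite 𝓀[K]] (h2 : (2 : K) ≠ 0) (h2v : Valued.v (2 : K) < 1)
    {ϖ : K} (hϖ : Valued.v ϖ = exp (-1 : ℤ)) {w : K} (hw1 : Valued.v w < 1) (h4w : Valued.v (4 : K) < Valued.v w)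
    (hwodd : ∀ y : K, Valued.v w ≠ Valued.v y * Valued.v y) :
    ∃ η : K, Valued.v η ≤ 1 ∧ (¬ ∃ a b : K, a * a - (1 + w) * (b * b) = 1 + 4 * η * w⁻¹) ∧
      ∀ y : K, y ≠ 0 → (∃ a b : K, a * a - (1 + w) * (b * b) = y) ∨ (∃ a b : K, a * a - (1 + w) * (b * b) = y * (1 + 4 * η * w⁻¹)) := by
  obtain ⟨η, hη1, hη⟩ := exists_forall_one_le_valued_artinSchreier_sub (K := K) h2v
  refine ⟨η, hη1, not_exists_sq_sub_one_add_mul_sq_eq_one_add_four_mul_mul_inv h2 h2v hw1 h4w hwodd hη1 hη, fun y hy0 => ?_⟩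
  exact exists_sq_sub_one_add_mul_sq_or_mul h2 h2v (exists_valued_mul_self_sub_lt_one_of_finite_residueField h2v)
    (fun a b ha hb ha' hb' => exists_artinSchreier_sub_add_of_finite_residueField h2v ha hb ha' hb') hϖ hw1 h4w hwodd hη1 hη hy0

end UnitIndexTwo

/-! ## The completion `F_v` of a number field at a dyadic place -/
section AdicCompletion
variable (F : Type*) [Field F] [NumberField F] (v : HeightOneSpectrum (𝓞 F))

/-- **INDEX TWO FOR A UNIT OF ODD DEFECT IN `F_v`** (a number field `F`, a dyadic place `v`: `v(2) < 1`; uniformiser binder; `v 4 < v w < 1`, `v w` not a square value): some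
`η ∈ 𝒪_v` has `x₀ = 1 + 4η∕w ∉ N(F_v(√(1+w))^×)` and `∀ y ≠ 0, y ∈ N ∨ y·x₀ ∈ N` — `[F_v^× : N(F_v(√(1+w))^×)] = 2`. [cite: Omeara1963, §63B 63:11a]
[cite: Serre1979, Ch. XV §2] [cite: NeukirchANT1999, Ch. V (1.3)] -/
theorem exists_norm_dichotomy_one_add_adicCompletion (h2v : Valued.v (2 : v.adicCompletion F) < 1) {ϖ : v.adicCompletion F}
    (hϖ : Valued.v ϖ = exp (-1 : ℤ)) {w : v.adicCompletion F} (hw1 : Valued.v w < 1) (h4w : Valued.v (4 : v.adicCompletion F) < Valued.v w)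
    (hwodd : ∀ y : v.adicCompletion F, Valued.v w ≠ Valued.v y * Valued.v y) :
    ∃ η : v.adicCompletion F, Valued.v η ≤ 1 ∧ (¬ ∃ a b : v.adicCompletion F, a * a - (1 + w) * (b * b) = 1 + 4 * η * w⁻¹) ∧
      ∀ y : v.adicCompletion F, y ≠ 0 →
        (∃ a b : v.adicCompletion F, a * a - (1 + w) * (b * b) = y) ∨ (∃ a b : v.adicCompletion F, a * a - (1 + w) * (b * b) = y * (1 + 4 * η * w⁻¹)) := by
  haveI := Literature.NumberTheory.Automorphic.isAdicComplete_valuedMaximalIdeal_valuedInteger_adicCompletion F v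
  haveI : Finite 𝓀[v.adicCompletion F] := Literature.NumberTheory.Automorphic.finite_residueField_adicCompletion F v
  have h2 : (2 : v.adicCompletion F) ≠ 0 := by
    rw [show (2 : v.adicCompletion F) = algebraMap F (v.adicCompletion F) 2 by rw [map_ofNat]]
    exact (_root_.map_ne_zero (algebraMap F (v.adicCompletion F))).2 two_ne_zero
  exact exists_norm_dichotomy_one_add_of_finite_residueField h2 h2v hϖ hw1 h4w hwodd

end AdicCompletion

end Literature.NumberTheory.LocalFields

end
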